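import Summits.SmoothPoincare4.SmoothPoincare4.Theorems.EntropyRungMargerinRailsDefs
import Literature.Geometry.Riemannian.HamiltonCurvatureODE
import Literature.Geometry.Riemannian.RicciFlowMaximal
import Literature.Geometry.Riemannian.ConstantCurvature
import Literature.Geometry.Riemannian.HamiltonConvergenceCriterion
import Mathlib.Analysis.SpecialFunctions.Pow.Real
import HarnessLib

/-!
# Route EntropyRung · crux `ChangGurskyYang` · line `margerin-cone-hamilton-rails` — STUB 4
# `stub_pinchedFlowConvergence`, closed MODULO Hamilton's convergence criterion (Hamilton 1986, §5, 5.2)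

STUB 4 of the skeleton `Cruxes/ChangGurskyYang/Lines/margerin-cone-hamilton-rails.lean` (crux
stmt-SmoothPoincare4-10834, `Summit.SmoothPoincare4.SmoothPoincare4.Theses.EntropyRung.ChangGurskyYang`)
is the ENDGAME of Margerin's leaf: a closed connected smooth 4-manifold `M` with a `C^∞` Riemannian
metric `g₀` such that EVERY Ricci flow of Riemannian metrics `(g, cov)` on `[0, T)` from `g₀` keeps the
Hamilton blocks `(A, B, C)` of every orthonormal frame in one pinching set
`Z = pinchingSet m c K τ = margerinCone c ∩ {R ≥ m} ∩ {|𝒟|² ≤ K R^{2−τ}}` (`m, c, K, τ > 0`, `c < 1/6`,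
`τ ≤ 1`; `R = tr A + tr C`, `|𝒟|² = ‖A‖² + 2‖B‖² + ‖C‖² − R²/6 = |W|² + 2|E|² = |R̊m|²`) carries a
`C^∞` Riemannian metric of constant sectional curvature `k > 0`.

In print this is **Hamilton 1986, §5** (J. Differential Geom. 24, pp. 163–164): §5, opening
sentence (p. 163) "All we need is to show that if `M̊` is the traceless part of `M`, then
`|M̊| ≤ C|M|^{1−δ}` for some `δ > 0` and some constant `C`"; Def. 5.1 (pinching set: closed, convex,
`O(n)`-invariant, ODE-invariant, `|M̊| ≤ C|M|^{1−δ}` on `Z`); **5.2 Convergence criterion** (p. 164):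
"If `U` satisfies the pinching condition, and `tr M > 0` for all `M ∈ Z`, then every metric whose
curvature lies in `U` will evolve as `t → ∞` to a metric of constant positive curvature", whose
printed proof is: the curvature operator lies in `X = P ×_G Z` at `t = 0`, "it will remain in `X` by
the argument in §4. This gives us the required pinching estimate `|M̊| ≤ C|M|^{1−δ}`", after which
(§2, p. 154) "the rest of the proof goes through unchanged" — Hamilton 1982, §§10–17 (gradient
estimate for `R`, Myers, `R_max/R_min → 1`, higher derivative estimates, convergence of the
normalised flow) = Huisken 1985, Thm. 3.1 (`|R̊m|² ≤ C R^{2−δ}`) and §4 "Gradient estimate and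
conclusion"; for the `β`-weak-pinching sets of this line it is Margerin
1998, Part VI (Cor. 25, Lemmas 26–27, pp. 53–57). None of this convergence theory is in the tree
(cf. the table of `HamiltonPCOClassificationProofs.lean`, node H1, and
`hamilton_positiveCurvatureOperator_classification_four_of_constantCurvature`, whose hypothesis `h₁`
is the same conclusion for Hamilton's `{M > 0}` pinching sets; `ricciFlow_maximal_existence` and
`ricciFlow_curvature_blowup` of `RicciFlowMaximal.lean` are themselves unproved named facts).

Accordingly this file

* USES the printed criterion as the named fact
  `Literature.Geometry.Riemannian.hamilton_convergenceCriterion_four`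
  (`Literature/Geometry/Riemannian/HamiltonConvergenceCriterion.lean`; stated inline by this line and
  relocated there by the gate, p83228): Hamilton 1986, 5.2 specialised to dimension four and to the
  explicit pinching sets `{R ≥ m} ∩ {|M̊|² ≤ K R^{2−τ}}` that STUB 4 consumes (frame/blocks form,
  along every Ricci flow from `g₀`, conclusion = existence of a metric of constant sectional
  curvature `k > 0`, the form in which the tree consumes convergence: node H1 above), written over
  Literature vocabulary only (`IsRicciFlow`, `blockA/B/C`, `IsOrthonormalFrame`,
  `HasConstantSectionalCurvature`) with the Frobenius sums spelled out;
* PROVES STUB 4 conditionally on it: `stub_pinchedFlowConvergence_of_convergenceCriterion`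
  (registered on the crux item; colon form `hamilton_convergenceCriterion_four → <STUB 4 verbatim>`).
  The bookkeeping is definitional: membership in `pinchingSet m c K τ` is membership in
  `margerinCone c` AND (`m ≤ scal p ∧ devNormSq p ≤ K * scal p ^ (2 - τ)`), and the second conjunct
  unfolds (`scal`, `devNormSq`, `rmNormSq`, `frobSq`) to the antecedent of the fact; the cone part
  `WP ≤ c < 1/6`, the initial fit at `t = 0` and `τ ≤ 1` are not needed by the criterion.

Disproof §3a/§3b (`Cruxes/ChangGurskyYang/Disproof.lean`) honoured: `[CompactSpace M]` and
`[ConnectedSpace M]` stay in the binders of both the fact and the stub (the flat torus is excluded by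
`m > 0`, `S⁴ ⊔ S⁴` by connectedness; the empty manifold by `ConnectedSpace`).

References: R. S. Hamilton, *Four-manifolds with positive curvature operator*, J. Differential
Geom. 24 (1986) 153–179: §2 (p. 154), §5, Def. 5.1 and 5.2 (pp. 163–164) [Hamilton1986];
R. S. Hamilton, *Three-manifolds with positive Ricci curvature*, J. Differential Geom. 17 (1982)
255–306, §§10–17 [Hamilton1982]; G. Huisken, *Ricci deformation of the metric on a Riemannian
manifold*, J. Differential Geom. 21 (1985) 47–62, Thm. 1.1, Thm. 3.1, §4 [Huisken1985]; C. Margerin,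
*A sharp characterization of the smooth 4-sphere in curvature terms*, Comm. Anal. Geom. 6 (1998)
21–65, Part VI, Cor. 25, Lemmas 26–27 [Margerin1998].
-/

noncomputable section

-- every `Summit.SmoothPoincare4.SmoothPoincare4.…` name repeats the summit = sub-problem segment (D-0017 layout)
set_option linter.dupNamespace false

open Set Function
open scoped Manifold ContDiff Matrix BigOperators Topology

namespace Summit.SmoothPoincare4.SmoothPoincare4.Theorems.MargerinRails

open Literature.Geometry.Riemannian Literature.Geometry.Riemannian.HamiltonODE
open Literature.Geometry.Lorentzian Literature.Geometry.Lorentzian.PseudoRiemannianMetric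

/-! ## STUB 4, conditionally on the criterion -/

/-- **STUB 4 of line `margerin-cone-hamilton-rails` (`stub_pinchedFlowConvergence`, verbatim),
conditional on Hamilton's convergence criterion `hamilton_convergenceCriterion_four`.** On a closed
connected smooth 4-manifold with `g₀` Riemannian, `0 < m`, `0 < c < 1/6`, `0 < K`, `0 < τ ≤ 1`, if the
blocks of `g₀` lie in `Z = pinchingSet m c K τ` and every Ricci flow of Riemannian metrics from `g₀`
keeps its blocks in `Z`, then `M` carries a `C^∞` Riemannian metric of constant sectional curvature
`k > 0`. Proof: `Z = margerinCone c ∩ {p | m ≤ scal p ∧ devNormSq p ≤ K * scal p ^ (2 - τ)}` and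
the second factor is, definitionally (`scal p = tr A + tr C`,
`devNormSq p = (Σ A² + 2 Σ B² + Σ C²) − (tr A + tr C)²/6`), the pinching hypothesis of the
criterion along every flow; the cone condition, the initial fit and `τ ≤ 1` are discarded.
(Margerin 1998, Part VI: "the `β`-weakly pinched flow converges, after normalisation, to constant
positive curvature" = Hamilton 1986, 5.2 for these sets.)
[cite: Hamilton1986, §5, 5.2 (p. 164)] [cite: Margerin1998, Part VI, Cor. 25, Lemmas 26–27 (pp. 53–57)] -/
theorem stub_pinchedFlowConvergence_of_convergenceCriterion :
    hamilton_convergenceCriterion_four →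
    ∀ (M : Type) [TopologicalSpace M] [T2Space M] [SecondCountableTopology M]
      [ChartedSpace (EuclideanSpace ℝ (Fin 4)) M] [IsManifold (𝓡 4) ∞ M] [CompactSpace M]
      [ConnectedSpace M]
      (g₀ : PseudoRiemannianMetric (𝓡 4) ∞ (EuclideanSpace ℝ (Fin 4)) (TangentSpace (𝓡 4) : M → Type _))
      (m c K τ : ℝ), g₀.IsRiemannian → 0 < m → 0 < c → c < 1 / 6 → 0 < K → 0 < τ → τ ≤ 1 →
      (∀ (cov : CovariantDerivative (𝓡 4) (EuclideanSpace ℝ (Fin 4)) (TangentSpace (𝓡 4) : M → Type _)),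
        g₀.IsLeviCivita cov →
        ∀ (x : M) (e : Fin 4 → TangentSpace (𝓡 4) x), g₀.IsOrthonormalFrame x e →
          (g₀.blockA cov x e, g₀.blockB cov x e, g₀.blockC cov x e) ∈ pinchingSet m c K τ) →
      (∀ (T : ℝ)
        (g : ℝ → PseudoRiemannianMetric (𝓡 4) ∞ (EuclideanSpace ℝ (Fin 4))
          (TangentSpace (𝓡 4) : M → Type _))
        (cov : ℝ → CovariantDerivative (𝓡 4) (EuclideanSpace ℝ (Fin 4))
          (TangentSpace (𝓡 4) : M → Type _)),
        IsRicciFlow g cov (Ico 0 T) → (∀ t ∈ Ico 0 T, (g t).IsRiemannian) → g 0 = g₀ →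
        ∀ t ∈ Ico 0 T, ∀ (x : M) (e : Fin 4 → TangentSpace (𝓡 4) x),
          (g t).IsOrthonormalFrame x e →
            ((g t).blockA (cov t) x e, (g t).blockB (cov t) x e, (g t).blockC (cov t) x e) ∈
              pinchingSet m c K τ) →
      ∃ (k : ℝ) (g' : PseudoRiemannianMetric (𝓡 4) ∞ (EuclideanSpace ℝ (Fin 4))
          (TangentSpace (𝓡 4) : M → Type _)),
        0 < k ∧ g'.IsRiemannian ∧ g'.HasConstantSectionalCurvature k := by
  intro hcrit M _ _ _ _ _ _ _ g₀ m c K τ hg₀ hm _ _ hK hτ _ _ hflow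
  exact hcrit M g₀ m K τ hg₀ hm hK hτ fun T g cov hRF hRiem h0 t ht x e he ↦
    (hflow T g cov hRF hRiem h0 t ht x e he).2

end Summit.SmoothPoincare4.SmoothPoincare4.Theorems.MargerinRails

end
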